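import Summits.RiemannHypothesis.RiemannHypothesis.Theorems.PfPersistenceGalerkinFormSeq
import Summits.RiemannHypothesis.RiemannHypothesis.Theorems.PfPersistenceGalerkinFourierDecay
import Summits.RiemannHypothesis.RiemannHypothesis.Theorems.PfPersistenceGalerkinFloorTransfer
import Literature.NumberTheory.LFunctions.WeilMellinBounds
import HarnessLib

/-!
# GAL-1 piece (ii′) PROVED: `TestToProfileFormDensity` (the profile / `Re Q` route — a SECOND route)

Cell `pub-rhpf` (even-sector Pólya-frequency campaign; a long-odds MECHANISM SEARCH — no RH claims),
seat `barrier-prover` g2. RH-free analysis; nothing about `RiemannHypothesis` is asserted. The GAL density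
input is already closed in the kernel by cand-3's closed-form route (`testToClosedFormDensity`,
`PfPersistenceGalerkinTestDensity`); this file closes the typed `Re Q`-form statement (ii′) of
`PfPersistenceGalerkinFloorTransfer` by window Fourier truncation — not load-bearing for GAL-1.

`theorem testToProfileFormDensity : TestToProfileFormDensity` — every smooth even real test `g` with
`tsupport g ⊆ [-a, a]` is approximated by cut-off cosine profiles `cutoffProfile (a, N) v` simultaneously
in `∫ ‖·‖²` and in `Re Q` (`PfPersistenceGalerkinFloorTransfer`).

Proof. Take `v = v_N`, the real cosine coefficients of the window Fourier truncation `P_N g`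
(`fourierRealCoeff`; `profileC (2a) v_N = fourierTrunc a g N`, `profileC_fourierRealCoeff`). Since `g`
is flat at `±a` (it and all its derivatives vanish there, `eq_zero_of_tsupport_subset`), three
integrations by parts give `‖c_n‖ ≤ K/|n|³` (`PfPersistenceGalerkinFourierDecay`), hence `P_N g → g` on
`[-a, a]` with `‖P_N g‖ ≤ M` and `∫_{-a}^{a} ‖(P_N g)'‖ ≤ D` uniformly in `N` (`PfPersistenceGalerkinFourier`),
and the fixed-radius sequence engine `tendsto_form_and_mass_cutoffAt_seq` (`PfPersistenceGalerkinFormSeq`)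
yields `Q(1_{[-a,a]} P_N g) → Q(g)` and `∫‖1_{[-a,a]} P_N g‖² → ∫‖g‖²` (`1_{[-a,a]} g = g`).
-/

noncomputable section

open Complex Filter Set MeasureTheory Topology Finset
open scoped Real ComplexConjugate Interval

namespace Summit.RiemannHypothesis.RiemannHypothesis.Theorems.PfPersistence

open Literature.NumberTheory.LFunctions

variable {a : ℝ} {g : ℝ → ℂ}

/-! ## §1 Flatness at the window ends -/

/-- A continuous function with `tsupport ⊆ [-a, a]` vanishes at `a` and at `-a`. [folklore] -/
theorem eq_zero_of_tsupport_subset {h : ℝ → ℂ} (hc : Continuous h) (hs : tsupport h ⊆ Icc (-a) a) :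
    h a = 0 ∧ h (-a) = 0 := by
  have key : ∀ x, h x ≠ 0 → ∃ ε > 0, Metric.ball x ε ⊆ Icc (-a) a := by
    intro x hx
    have ho : IsOpen (h ⁻¹' {0}ᶜ) := isOpen_compl_singleton.preimage hc
    obtain ⟨ε, hε, hball⟩ := Metric.isOpen_iff.1 ho x hx
    exact ⟨ε, hε, fun y hy ↦ hs (subset_tsupport h (hball hy))⟩
  constructor
  · by_contra hne
    obtain ⟨ε, hε, hball⟩ := key a hne
    have hmem : a + ε / 2 ∈ Metric.ball a ε := by
      rw [Metric.mem_ball, Real.dist_eq, show a + ε / 2 - a = ε / 2 by ring, abs_of_pos (by linarith)]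
      linarith
    have := (hball hmem).2
    linarith
  · by_contra hne
    obtain ⟨ε, hε, hball⟩ := key (-a) hne
    have hmem : -a - ε / 2 ∈ Metric.ball (-a) ε := by
      rw [Metric.mem_ball, Real.dist_eq, show -a - ε / 2 - -a = -(ε / 2) by ring, abs_neg,
        abs_of_pos (by linarith)]
      linarith
    have := (hball hmem).1
    linarith

/-- `1_{[-a,a]} g = g` when `tsupport g ⊆ [-a, a]`. [folklore] -/
theorem cutoffAt_eq_self_of_tsupport (hs : tsupport g ⊆ Icc (-a) a) : cutoffAt a g = g := by
  funext x
  by_cases hx : x ∈ Icc (-a) a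
  · exact indicator_of_mem hx _
  · rw [cutoffAt, indicator_of_notMem hx]
    exact (image_eq_zero_of_notMem_tsupport fun h ↦ hx (hs h)).symm

/-! ## §2 The real cosine coefficients of the truncation -/

/-- The coefficient vector `v_N` with `profile (2a) v_N = P_N g` (for even real `g`). [folklore] -/
def fourierRealCoeff (a : ℝ) (g : ℝ → ℂ) (N : ℕ) : Fin (N + 1) → ℝ := fun n ↦
  if (n : ℕ) = 0 then Real.sqrt (2 * a) * (testCoeff a g 0).re
  else (-1) ^ (n : ℕ) * (2 * Real.sqrt a) * (testCoeff a g n).re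

/-- **Profile = truncation**: `profileC (2a) v_N = P_N g` for even real `g`. [folklore] -/
theorem profileC_fourierRealCoeff (ha : 0 < a) (hge : ∀ x, g (-x) = g x)
    (hgr : ∀ x, conj (g x) = g x) (N : ℕ) :
    profileC (2 * a) (fourierRealCoeff a g N) = fourierTrunc a g N := by
  have hreal : ∀ n : ℤ, ((testCoeff a g n).re : ℂ) = testCoeff a g n :=
    fun n ↦ Complex.conj_eq_iff_re.1 (conj_testCoeff_of_even_real ha hge hgr n)
  have hsa : Real.sqrt a ≠ 0 := (Real.sqrt_pos.2 ha).ne'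
  have hs2a : Real.sqrt (2 * a) ≠ 0 := (Real.sqrt_pos.2 (by positivity)).ne'
  have hsq : Real.sqrt (2 / (2 * a)) = 1 / Real.sqrt a := by
    rw [show 2 / (2 * a) = 1 / a by field_simp, Real.sqrt_div' _ ha.le, Real.sqrt_one]
  funext y
  simp only [profileC, profile, fourierTrunc]
  rw [Complex.ofReal_sum, Finset.sum_range]
  refine Finset.sum_congr rfl fun n _ ↦ ?_
  by_cases hn : (n : ℕ) = 0
  · simp only [fourierRealCoeff, xiEven, fourierTerm, hn, if_true]
    rw [show Real.sqrt (2 * a) * (testCoeff a g 0).re * (1 / Real.sqrt (2 * a)) =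
      (testCoeff a g 0).re by field_simp]
    exact hreal 0
  · simp only [fourierRealCoeff, xiEven, fourierTerm, hn, if_false]
    have h1 : ((-1 : ℝ)) ^ (n : ℕ) * ((-1 : ℝ)) ^ (n : ℕ) = 1 := by
      rw [← mul_pow]; norm_num
    have h2 : (2 : ℝ) * Real.sqrt a * (1 / Real.sqrt a) = 2 := by field_simp
    have e : (-1 : ℝ) ^ (n : ℕ) * (2 * Real.sqrt a) * (testCoeff a g n).re *
        ((-1 : ℝ) ^ (n : ℕ) * Real.sqrt (2 / (2 * a)) * Real.cos (2 * π * (n : ℕ) * y / (2 * a))) =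
        (testCoeff a g n).re * (2 * Real.cos (2 * π * (n : ℕ) * y / (2 * a))) := by
      rw [hsq]
      calc (-1 : ℝ) ^ (n : ℕ) * (2 * Real.sqrt a) * (testCoeff a g n).re *
            ((-1 : ℝ) ^ (n : ℕ) * (1 / Real.sqrt a) * Real.cos (2 * π * (n : ℕ) * y / (2 * a)))
          = ((-1 : ℝ) ^ (n : ℕ) * (-1 : ℝ) ^ (n : ℕ)) * ((2 : ℝ) * Real.sqrt a * (1 / Real.sqrt a)) *
              ((testCoeff a g n).re * Real.cos (2 * π * (n : ℕ) * y / (2 * a))) := by ring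
        _ = (testCoeff a g n).re * (2 * Real.cos (2 * π * (n : ℕ) * y / (2 * a))) := by
            rw [h1, h2]; ring
    have hθ : cexp (2 * π * I * ((n : ℕ) : ℂ) * y / (2 * a)) +
        cexp (2 * π * I * (-((n : ℕ) : ℂ)) * y / (2 * a)) =
        2 * ((Real.cos (2 * π * (n : ℕ) * y / (2 * a)) : ℝ) : ℂ) := by
      rw [Complex.ofReal_cos, Complex.two_cos]
      congr 1
      · congr 1; push_cast; ring
      · congr 1; push_cast; ring
    rw [e, hθ]
    conv_rhs => rw [← hreal (n : ℕ)]
    push_cast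
    ring

/-- `cutoffProfile (a, N) v_N = 1_{[-a,a]} P_N g`. [folklore] -/
theorem cutoffProfile_fourierRealCoeff (ha : 0 < a) (hge : ∀ x, g (-x) = g x)
    (hgr : ∀ x, conj (g x) = g x) (N : ℕ) :
    cutoffProfile ⟨a, N, ha⟩ (fourierRealCoeff a g N) = cutoffAt a (fourierTrunc a g N) := by
  rw [cutoffProfile_eq_indicator, cutoffAt]
  simp only
  rw [profileC_fourierRealCoeff ha hge hgr N]

/-! ## §3 The theorem -/

/-- **GAL-1 piece (ii′) PROVED.** Smooth even real tests on `[-a, a]` are form-approximated by cut-off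
cosine profiles. [folklore] -/
theorem testToProfileFormDensity : TestToProfileFormDensity := by
  intro a ha g hg hsupp hge him δ hδ
  have hgr : ∀ x, conj (g x) = g x := fun x ↦ Complex.conj_eq_iff_im.2 (him x)
  -- derivatives
  have hd1 : IsWeilTest (deriv g) := hg.deriv
  have hd2 : IsWeilTest (deriv (deriv g)) := hd1.deriv
  have hd3 : IsWeilTest (deriv (deriv (deriv g))) := hd2.deriv
  have h0 : ∀ x, HasDerivAt g (deriv g x) x := fun x ↦ (hg.1.differentiable (by simp) x).hasDerivAt
  have h1 : ∀ x, HasDerivAt (deriv g) (deriv (deriv g) x) x :=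
    fun x ↦ (hd1.1.differentiable (by simp) x).hasDerivAt
  have h2 : ∀ x, HasDerivAt (deriv (deriv g)) (deriv (deriv (deriv g)) x) x :=
    fun x ↦ (hd2.1.differentiable (by simp) x).hasDerivAt
  have hc3 : Continuous (deriv (deriv (deriv g))) := hd3.1.continuous
  have hgc : Continuous g := hg.1.continuous
  -- flatness at `±a`
  have hs1 : tsupport (deriv g) ⊆ Icc (-a) a := tsupport_deriv_subset.trans hsupp
  have hs2 : tsupport (deriv (deriv g)) ⊆ Icc (-a) a := tsupport_deriv_subset.trans hs1
  have hf0 : g a = g (-a) := (hge a).symm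
  have hf1 : deriv g a = deriv g (-a) := by
    obtain ⟨e1, e2⟩ := eq_zero_of_tsupport_subset hd1.1.continuous hs1; rw [e1, e2]
  have hf2 : deriv (deriv g) a = deriv (deriv g) (-a) := by
    obtain ⟨e1, e2⟩ := eq_zero_of_tsupport_subset hd2.1.continuous hs2; rw [e1, e2]
  -- summabilities of the window coefficients
  have hsZ := summable_norm_testCoeff_int ha h0 h1 h2 hc3 hf0 hf1 hf2
  have hsN := summable_norm_testCoeff_nat ha h0 h1 h2 hc3 hf0 hf1 hf2
  have hsN1 := summable_mul_norm_testCoeff_nat ha h0 h1 h2 hc3 hf0 hf1 hf2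
  -- the sequence engine
  set M : ℝ := 2 * ∑' n : ℕ, ‖testCoeff a g n‖
  set D₀ : ℝ := 2 * π / a * ∑' n : ℕ, (n : ℝ) * ‖testCoeff a g n‖
  have hM : ∀ N, ∀ x ∈ Icc (-a) a, ‖fourierTrunc a g N x‖ ≤ M :=
    fun N x _ ↦ norm_fourierTrunc_le hsN N x
  have hD : ∀ N, (∫ x in (-a)..a, ‖fourierTruncDeriv a g N x‖) ≤ (a - -a) * D₀ := by
    intro N
    calc (∫ x in (-a)..a, ‖fourierTruncDeriv a g N x‖) ≤ ∫ x in (-a)..a, D₀ :=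
          intervalIntegral.integral_mono_on (by linarith)
            ((continuous_fourierTruncDeriv a g N).norm.intervalIntegrable _ _)
            intervalIntegrable_const fun x _ ↦ norm_fourierTruncDeriv_le ha hsN1 N x
      _ = (a - -a) * D₀ := by rw [intervalIntegral.integral_const, smul_eq_mul]
  have hpt : ∀ x ∈ Icc (-a) a, Tendsto (fun N ↦ fourierTrunc a g N x) atTop (𝓝 (g x)) :=
    fun x hx ↦ tendsto_fourierTrunc ha hgc hge hsZ hx
  obtain ⟨hW, hmass⟩ := tendsto_form_and_mass_cutoffAt_seq ha.le
    (fun N x ↦ hasDerivAt_fourierTrunc a g N x) (fun N ↦ continuous_fourierTruncDeriv a g N) hgc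
    hM hD hpt
  -- identify the limits with `Q(g)` and `∫‖g‖²`
  have hcut : cutoffAt a g = g := cutoffAt_eq_self_of_tsupport hsupp
  have haut : autocorrAt a g = weilConv g (weilReflect g) := by
    simp only [autocorrAt, hcut]
  rw [haut] at hW
  rw [hcut] at hmass
  have hWre := ((Complex.continuous_re.tendsto _).comp hW)
  obtain ⟨N₁, hN₁⟩ := Metric.tendsto_atTop.1 hmass δ hδ
  obtain ⟨N₂, hN₂⟩ := Metric.tendsto_atTop.1 hWre δ hδ
  refine ⟨max N₁ N₂, fourierRealCoeff a g (max N₁ N₂), ?_, ?_⟩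
  · have h := hN₁ (max N₁ N₂) (le_max_left _ _)
    rw [Real.dist_eq] at h
    rw [cutoffProfile_fourierRealCoeff ha hge hgr]
    exact h.le
  · have h := hN₂ (max N₁ N₂) (le_max_right _ _)
    rw [Real.dist_eq, Function.comp_apply] at h
    rw [cutoffProfile_fourierRealCoeff ha hge hgr]
    exact h.le

end Summit.RiemannHypothesis.RiemannHypothesis.Theorems.PfPersistence
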